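import Summits.AtomisticToContinuum.HydrodynamicLimit.Theorems.CollisionIsometryCLTAdaptedWeightCLTTLPastDampingDecomposition
import Summits.AtomisticToContinuum.HydrodynamicLimit.Theorems.CollisionIsometryCLTAdaptedWeightCLTTLPastDampingKernel
import Summits.AtomisticToContinuum.HydrodynamicLimit.Theorems.CollisionIsometryCLTAdaptedWeightCLTTLReductionMeasurable
import Summits.AtomisticToContinuum.HydrodynamicLimit.Theorems.CollisionIsometryCLTAdaptedWeightCLTTLReductionFlow
import Summits.AtomisticToContinuum.HydrodynamicLimit.Theorems.CollisionIsometryCLTAdaptedWeightCLTTLColumnDepolarisationRate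
import Summits.AtomisticToContinuum.HydrodynamicLimit.Theorems.CollisionIsometryCLTAdaptedWeightCLTTLStubFlowDictionary
import Literature.MathematicalPhysics.KineticTheory.HardSphereEulerProofs
import Literature.MathematicalPhysics.KineticTheory.HardSphereTwoTimePressure

/-!
# Stub `stub_pastDamping` of the line `contact-source-duhamel` — helper file: the LINE WINDOWS ALONG
THE FLOW, measurably and on a horizon (crux `CollisionIsometryCLT.AdaptedWeightCLT`,
stmt-AtomisticToContinuum-14868, `--supports`)

Measure-theoretic bookkeeping for the per-horizon inputs of the PAST estimate:

* the COLUMN-DEPOLARISATION WINDOW FUNCTIONAL `cdWin = cd2 + cd3x` of the window ending at `s`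
  (`0 ≤ cdWin ≤ 84`) is measurable in the window start (`measurable_cdSum`: countably many values of the
  number of fold steps, each a polynomial in the transported tensors, `Reduction.measurable_tTransport`),
  jointly measurable in `(s, z)` after modification of the flow off the good set (`cdWinMod`,
  `measurable_cdWinMod`, `BoltzmannGreenKuboOrthMomentum.measurable_flowMod`), and equal to the
  integrand of `CDAlongAt` at horizon `s` once `Δℓ_N ≤ s` (`cdWinMod_eq_of_le`);
* DOMINATED CONVERGENCE IN THE HORIZON: `CDAlongAt` (a statement for every fixed horizon) gives
  `∫₀ᵗ E_N[cdWin(s)] ds → 0` (`tendsto_lintegral_cdWinMod`), the expectation being measurable in `s`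
  and bounded by `84`;
* the EXPONENTIAL MOMENT along a good orbit is measurable and bounded in time, the integrand of
  `TailsOn` is `expMoment` (`tails_integral_eq`), the energy is bounded by its time average
  (`sum_sq_le_of_tails`), and the window starts cost at most twice the horizon integral
  (`integral_expMoment_winStart_le`);
* the FEW-STEPS input in real form (`integral_steps_le_of_fewSteps`).
-/

namespace Summit.AtomisticToContinuum.HydrodynamicLimit.Theorems.ContactSourceDuhamel.TimeLocal
namespace PastDamping

open scoped BigOperators Topology Classical MeasureTheory ENNReal InnerProductSpace
open Filter Set MeasureTheory
open Literature.Analysis.FluidPDE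
open Literature.MathematicalPhysics.KineticTheory (hsDiameter localGibbsLaw)
open Summit.AtomisticToContinuum.HydrodynamicLimit.Theorems.BoltzmannGreenKuboOrthMomentum (flowMod
  flowMod_of_mem measurable_flowMod)

noncomputable section

variable {σ : ℝ} {N : ℕ}

/-! ## The column-depolarisation window functional -/

/-- The sum `cd2 + cd3x` of a window start `y` over `[0, Δ]`. -/
def cdSum (σ : ℝ) (N : ℕ) (y : Cfg N) (Δ : ℝ) : ℝ := cd2 σ N y Δ + cd3x σ N y Δ

/-- `0 ≤ cdSum ≤ 84`. -/
theorem cdSum_mem (σ : ℝ) (N : ℕ) (y : Cfg N) (Δ : ℝ) : 0 ≤ cdSum σ N y Δ ∧ cdSum σ N y Δ ≤ 84 :=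
  ⟨add_nonneg (ColumnDepolarisation.cd2_nonneg Δ) (ColumnDepolarisation.cd3x_nonneg Δ),
    by have := ColumnDepolarisation.cd2_le_six σ N y Δ; have := ColumnDepolarisation.cd3x_le σ N y Δ
       unfold cdSum; linarith⟩

/-- The one-site transports are measurable in the window start (fixed number of steps). -/
theorem measurable_tTransport_single (hG : (Torus.geometry (Fin 3)).IsHardSphereRegular (hsDiameter σ N))
    (r m : ℕ) (k : Fin (N + 1)) (a : V3) :
    Measurable fun y : Cfg N => tTransport r σ N y 0 m (Pi.single k (tpow r a)) :=
  ((Reduction.measurable_tTransport (r := r) hG 0 m).comp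
    (measurable_id.prodMk (measurable_const (a := (Pi.single k (tpow r a) : Fin (N + 1) → Tens r)))) :)

/-- The clouds are measurable in the window start (fixed number of steps). -/
theorem measurable_cloud (hG : (Torus.geometry (Fin 3)).IsHardSphereRegular (hsDiameter σ N)) (r m : ℕ)
    (k : Fin (N + 1)) (a : V3) : Measurable fun y : Cfg N => cloud r σ N y m k a := by
  have h := measurable_tTransport_single hG r m k a
  show Measurable fun y : Cfg N => ∑ i, tTransport r σ N y 0 m (Pi.single k (tpow r a)) i
  exact Finset.measurable_sum _ fun i _ => (measurable_pi_apply i).comp h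

/-- `normSqT` of a measurable tensor field is measurable. -/
theorem measurable_normSqT {α : Type*} [MeasurableSpace α] {r : ℕ} {f : α → Tens r} (hf : Measurable f) :
    Measurable fun a => normSqT (f a) :=
  Finset.measurable_sum _ fun idx _ => ((measurable_pi_apply idx).comp hf).pow_const 2

/-- **`cdSum` is measurable in the window start** (split by the countably many values of the number
of fold steps). -/
theorem measurable_cdSum (hG : (Torus.geometry (Fin 3)).IsHardSphereRegular (hsDiameter σ N)) (Δ : ℝ) :
    Measurable fun y : Cfg N => cdSum σ N y Δ := by
  have hF : ∀ m : ℕ, Measurable fun y : Cfg N =>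
      ((N + 1 : ℕ) : ℝ)⁻¹ * ∑ k : Fin (N + 1), ∑ p : Fin 3, ∑ q : Fin 3,
          normSqT (cloud 2 σ N y m k (dirV p q) - iso2 (dirV p q)) +
        ((N + 1 : ℕ) : ℝ)⁻¹ * ∑ k : Fin (N + 1), ∑ p : Fin 10, normSqT (cloud 3 σ N y m k (udir p)) := by
    intro m
    refine ((Finset.measurable_sum _ fun k _ => Finset.measurable_sum _ fun p _ =>
      Finset.measurable_sum _ fun q _ => measurable_normSqT ?_).const_mul _).add
      ((Finset.measurable_sum _ fun k _ => Finset.measurable_sum _ fun p _ =>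
        measurable_normSqT (measurable_cloud hG 3 m k _)).const_mul _)
    exact (measurable_cloud hG 2 m k _).sub measurable_const
  exact Reduction.measurable_of_countable_cases (o := fun y : Cfg N => steps σ N y Δ)
    (fun m => (Alexander.measurable_collisionCount hG Reduction.gm Δ) (measurableSet_singleton m)) hF

/-- The window functional along the MODIFIED flow, as a function of `(s, z)`: the value of `cdSum` for
the window ending at `s` (start `s − winLen N s`, length `winLen N s`). -/
def cdWinMod (σ : ℝ) (N : ℕ) (Φ : Flow σ N) (p : ℝ × Cfg N) : ℝ :=
  if p.1 < Δℓ N then cdSum σ N (flowMod Φ (p.1 - 0, p.2)) 0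
  else cdSum σ N (flowMod Φ (p.1 - Δℓ N, p.2)) (Δℓ N)

/-- `cdWinMod` is jointly measurable. -/
theorem measurable_cdWinMod (hG : (Torus.geometry (Fin 3)).IsHardSphereRegular (hsDiameter σ N))
    (Φ : Flow σ N) : Measurable (cdWinMod σ N Φ) := by
  unfold cdWinMod
  refine Measurable.ite (measurableSet_lt measurable_fst measurable_const) ?_ ?_
  · exact (measurable_cdSum hG 0).comp ((measurable_flowMod Φ).comp
      ((measurable_fst.sub measurable_const).prodMk measurable_snd))
  · exact (measurable_cdSum hG (Δℓ N)).comp ((measurable_flowMod Φ).comp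
      ((measurable_fst.sub measurable_const).prodMk measurable_snd))

/-- `0 ≤ cdWinMod ≤ 84`. -/
theorem cdWinMod_mem (Φ : Flow σ N) (p : ℝ × Cfg N) : 0 ≤ cdWinMod σ N Φ p ∧ cdWinMod σ N Φ p ≤ 84 := by
  unfold cdWinMod
  split_ifs <;> exact cdSum_mem σ N _ _

/-- On the good set `cdWinMod` is the window functional of the true flow. -/
theorem cdWinMod_eq_of_mem (Φ : Flow σ N) {z : Cfg N} (hz : z ∈ Φ.good) (s : ℝ) :
    cdWinMod σ N Φ (s, z) = cdSum σ N (winStart σ N Φ s z) (winLen N s) := by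
  unfold cdWinMod winStart winLen
  simp only [flowMod_of_mem Φ hz]
  split_ifs <;> rfl

/-- Past the initial layer `cdWinMod` is the integrand of `CDAlongAt` at horizon `s` (good data). -/
theorem cdWinMod_eq_of_le (Φ : Flow σ N) {z : Cfg N} (hz : z ∈ Φ.good) {s : ℝ} (hs : Δℓ N ≤ s) :
    cdWinMod σ N Φ (s, z) = cd2 σ N (Φ.flow (s - Δℓ N) z) (Δℓ N) + cd3x σ N (Φ.flow (s - Δℓ N) z) (Δℓ N) := by
  unfold cdWinMod
  simp only [flowMod_of_mem Φ hz, not_lt.2 hs, if_false]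
  rfl

/-! ## Dominated convergence in the horizon -/

/-- The expected window functional at horizon `s`: `E_N[cdWinMod(s, ·)]` as a lower integral. -/
def cdMean (σ : ℝ) (a₀ θ₀ : T3 → ℝ) (u₀ : T3 → V3) (Φ : Flows σ) (N : ℕ) (s : ℝ) : ℝ≥0∞ :=
  ∫⁻ z, ENNReal.ofReal (cdWinMod σ N (Φ N) (s, z)) ∂(localGibbsLaw σ a₀ u₀ θ₀ N (Φ N))

/-- The local Gibbs laws are probability measures (nice profiles, `σ < 1/2`). -/
theorem isProbabilityMeasure_lg {a₀ θ₀ : T3 → ℝ} {u₀ : T3 → V3} (hnice : NiceProfiles a₀ θ₀ u₀)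
    (hσ2 : σ < 2⁻¹) (N : ℕ) (Φ : Flow σ N) : IsProbabilityMeasure (localGibbsLaw σ a₀ u₀ θ₀ N Φ) :=
  Literature.MathematicalPhysics.KineticTheory.isProbabilityMeasure_localGibbsLaw hnice.1 hnice.2.1
    hnice.2.2.1 hnice.2.2.2.1 hnice.2.2.2.2 (by linarith [show (2:ℝ)⁻¹ = 1 / 2 by norm_num]) N Φ

/-- `cdMean` is measurable in the horizon. -/
theorem measurable_cdMean (hσ : 0 < σ) (hσ2 : σ < 2⁻¹) {a₀ θ₀ : T3 → ℝ} {u₀ : T3 → V3}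
    (hnice : NiceProfiles a₀ θ₀ u₀) (Φ : Flows σ) (N : ℕ) : Measurable (cdMean σ a₀ θ₀ u₀ Φ N) := by
  haveI := isProbabilityMeasure_lg hnice hσ2 N (Φ N)
  exact (ENNReal.measurable_ofReal.comp (measurable_cdWinMod (FlowDict.regular_hsDiameter hσ.le hσ2 N)
    (Φ N))).lintegral_prod_right'

/-- `cdMean ≤ 84`. -/
theorem cdMean_le (hσ2 : σ < 2⁻¹) {a₀ θ₀ : T3 → ℝ} {u₀ : T3 → V3} (hnice : NiceProfiles a₀ θ₀ u₀)
    (Φ : Flows σ) (N : ℕ) (s : ℝ) : cdMean σ a₀ θ₀ u₀ Φ N s ≤ 84 := by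
  haveI := isProbabilityMeasure_lg hnice hσ2 N (Φ N)
  calc cdMean σ a₀ θ₀ u₀ Φ N s ≤ ∫⁻ _z, (84 : ℝ≥0∞) ∂(localGibbsLaw σ a₀ u₀ θ₀ N (Φ N)) := by
        refine lintegral_mono fun z => ?_
        have h := (cdWinMod_mem (Φ N) (s, z)).2
        calc ENNReal.ofReal (cdWinMod σ N (Φ N) (s, z)) ≤ ENNReal.ofReal 84 := ENNReal.ofReal_le_ofReal h
          _ = 84 := by norm_num
    _ = 84 := by rw [lintegral_const, measure_univ, mul_one]

/-- **`CDAlongAt` gives `cdMean(s) → 0` for every `s > 0`** (eventually `Δℓ_N ≤ s`, and then the two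
integrands agree on the good set, which carries the local Gibbs law). -/
theorem tendsto_cdMean {a₀ θ₀ : T3 → ℝ} {u₀ : T3 → V3} {Φ : Flows σ}
    (hCD : CDAlongAt σ a₀ θ₀ u₀ Φ) {s : ℝ} (hs : 0 < s) :
    Tendsto (fun N => cdMean σ a₀ θ₀ u₀ Φ N s) atTop (𝓝 0) := by
  have hev : ∀ᶠ N : ℕ in atTop, Δℓ N ≤ s :=
    (ColumnDepolarisation.tendsto_lineWindow_nhds_zero.eventually (gt_mem_nhds hs)).mono fun N h => h.le
  refine (hCD s hs).congr' (hev.mono fun N hN => ?_)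
  refine lintegral_congr_ae ?_
  have hae : ∀ᵐ z ∂(localGibbsLaw σ a₀ u₀ θ₀ N (Φ N)), z ∈ (Φ N).good :=
    (Literature.MathematicalPhysics.KineticTheory.localGibbsLaw_absolutelyContinuous σ a₀ u₀ θ₀ N
      (Φ N)).ae_le (Φ N).ae_mem_good
  filter_upwards [hae] with z hz
  rw [cdWinMod_eq_of_le (Φ N) hz hN]

/-- **Dominated convergence in the horizon**: `∫₀ᵗ cdMean_N(s) ds → 0`. -/
theorem tendsto_lintegral_cdMean (hσ : 0 < σ) (hσ2 : σ < 2⁻¹) {a₀ θ₀ : T3 → ℝ} {u₀ : T3 → V3}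
    (hnice : NiceProfiles a₀ θ₀ u₀) {Φ : Flows σ} (hCD : CDAlongAt σ a₀ θ₀ u₀ Φ) (t : ℝ) :
    Tendsto (fun N => ∫⁻ s in Icc 0 t, cdMean σ a₀ θ₀ u₀ Φ N s) atTop (𝓝 0) := by
  have h := tendsto_lintegral_of_dominated_convergence (μ := volume.restrict (Icc 0 t))
    (F := fun N s => cdMean σ a₀ θ₀ u₀ Φ N s) (f := fun _ => 0) (fun _ => 84)
    (fun N => measurable_cdMean hσ hσ2 hnice Φ N)
    (fun N => ae_of_all _ fun s => cdMean_le hσ2 hnice Φ N s) ?_ ?_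
  · simpa using h
  · rw [lintegral_const, Measure.restrict_apply_univ]
    exact ENNReal.mul_ne_top (by norm_num) measure_Icc_lt_top.ne
  · -- pointwise for `s > 0`, and `{0}` is null
    have hnull : (volume.restrict (Icc 0 t)) {s | ¬ 0 < s} = 0 := by
      rw [Measure.restrict_apply' measurableSet_Icc]
      refine measure_mono_null (fun s hs => ?_) (Real.volume_singleton (a := 0))
      have h1 : ¬ 0 < s := hs.1
      have h2 : 0 ≤ s := hs.2.1
      exact le_antisymm (not_lt.1 h1) h2
    have hae : ∀ᵐ s ∂(volume.restrict (Icc 0 t)), 0 < s := by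
      rw [ae_iff]; exact hnull
    filter_upwards [hae] with s hs
    exact tendsto_cdMean hCD hs

/-! ## Exponential moments along a good orbit -/

/-- `expMoment` is measurable in the configuration. -/
theorem measurable_expMoment (lam : ℝ) (N : ℕ) : Measurable fun z : Cfg N => expMoment lam N z := by
  unfold expMoment
  refine (Finset.measurable_sum _ fun i _ => ?_).const_mul _
  exact Real.measurable_exp.comp (((Geometry.IsMeasurable.measurable_vel i).norm.pow_const 2).const_mul _)

/-- Along a good orbit the exponential moment is measurable in time. -/
theorem measurable_expMoment_flow (lam : ℝ) (Φ : Flow σ N) {z : Cfg N} (hz : z ∈ Φ.good) :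
    Measurable fun s => expMoment lam N (Φ.flow s z) :=
  (measurable_expMoment lam N).comp (Reduction.measurable_flow_of_mem_good Φ hz)

/-- Along a good orbit the exponential moment is bounded in time (velocities `≤ vR z`). -/
theorem expMoment_flow_le {lam : ℝ} (hlam : 0 ≤ lam) (Φ : Flow σ N) {z : Cfg N} (hz : z ∈ Φ.good)
    (s : ℝ) : expMoment lam N (Φ.flow s z) ≤ Real.exp (lam * Reduction.vR z ^ 2) := by
  unfold expMoment
  have hN : (0 : ℝ) < ((N + 1 : ℕ) : ℝ) := by positivity
  rw [inv_mul_le_iff₀ hN]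
  calc ∑ i, Real.exp (lam * ‖(Φ.flow s z i).2‖ ^ 2) ≤ ∑ _i : Fin (N + 1), Real.exp (lam * Reduction.vR z ^ 2) :=
        Finset.sum_le_sum fun i _ => Real.exp_le_exp.2 (mul_le_mul_of_nonneg_left
          (pow_le_pow_left₀ (norm_nonneg _) (Reduction.norm_vel_flow_le Φ hz s i) 2) hlam)
    _ = ((N + 1 : ℕ) : ℝ) * Real.exp (lam * Reduction.vR z ^ 2) := by
        rw [Finset.sum_const, Finset.card_univ, Fintype.card_fin, nsmul_eq_mul]

/-- Along a good orbit the exponential moment is integrable on every horizon. -/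
theorem integrableOn_expMoment_flow {lam : ℝ} (hlam : 0 ≤ lam) (Φ : Flow σ N) {z : Cfg N}
    (hz : z ∈ Φ.good) (a b : ℝ) : IntegrableOn (fun s => expMoment lam N (Φ.flow s z)) (Icc a b) := by
  refine IntegrableOn.of_bound measure_Icc_lt_top
    (measurable_expMoment_flow lam Φ hz).aestronglyMeasurable.restrict (Real.exp (lam * Reduction.vR z ^ 2)) ?_
  refine ae_of_all _ fun s => ?_
  rw [Real.norm_eq_abs, abs_of_nonneg (expMoment_nonneg lam N _)]
  exact expMoment_flow_le hlam Φ hz s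

/-- The integrand of `TailsOn` is the exponential moment along the flow. -/
theorem tails_integral_eq (lam : ℝ) (Φ : Flow σ N) (z : Cfg N) (t : ℝ) :
    ∫ s in Icc 0 t, ∫ y, Real.exp (lam * ‖y.2‖ ^ 2) ∂(empiricalMeasure (Φ.flow s z)) =
      ∫ s in Icc 0 t, expMoment lam N (Φ.flow s z) :=
  integral_congr_ae (ae_of_all _ fun s => expMoment_eq lam (Φ.flow s z))

/-- **The energy against the time-averaged exponential moment**: on a good orbit with
`∫₀ᵗ expMoment ≤ Cexp` (`t > 0`, `λ > 0`), `Σ_j ‖v_j‖² ≤ (N+1) Cexp/(λ t)`. -/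
theorem sum_sq_le_of_tails {lam : ℝ} (hlam : 0 < lam) (Φ : Flow σ N) {z : Cfg N} (hz : z ∈ Φ.good)
    {t Cexp : ℝ} (ht : 0 < t) (h : ∫ s in Icc 0 t, expMoment lam N (Φ.flow s z) ≤ Cexp) :
    ∑ j, ‖(z j).2‖ ^ 2 ≤ ((N + 1 : ℕ) : ℝ) * Cexp / (lam * t) := by
  have hN : (0 : ℝ) < ((N + 1 : ℕ) : ℝ) := by positivity
  -- pointwise in time: `λ (N+1)⁻¹ Σ ‖v(s)‖² ≤ expMoment(s)` and the energy is conserved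
  have hpt : ∀ s, lam * (((N + 1 : ℕ) : ℝ)⁻¹ * ∑ j, ‖(z j).2‖ ^ 2) ≤ expMoment lam N (Φ.flow s z) := by
    intro s
    have h1 := sum_sq_norm_le_expMoment hlam (Φ.flow s z)
    rw [Reduction.sum_sq_flow Φ hz s] at h1
    rw [← mul_assoc]
    calc lam * ((N + 1 : ℕ) : ℝ)⁻¹ * ∑ j, ‖(z j).2‖ ^ 2
        ≤ lam * ((N + 1 : ℕ) : ℝ)⁻¹ * (lam⁻¹ * (((N + 1 : ℕ) : ℝ) * expMoment lam N (Φ.flow s z))) :=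
          mul_le_mul_of_nonneg_left h1 (by positivity)
      _ = expMoment lam N (Φ.flow s z) := by field_simp
  -- integrate over `[0, t]`
  have hconst : ∫ _s in Icc 0 t, lam * (((N + 1 : ℕ) : ℝ)⁻¹ * ∑ j, ‖(z j).2‖ ^ 2) =
      t * (lam * (((N + 1 : ℕ) : ℝ)⁻¹ * ∑ j, ‖(z j).2‖ ^ 2)) := by
    rw [setIntegral_const, smul_eq_mul, measureReal_def, Real.volume_Icc, sub_zero, ENNReal.toReal_ofReal ht.le]
  have hmono : ∫ _s in Icc 0 t, lam * (((N + 1 : ℕ) : ℝ)⁻¹ * ∑ j, ‖(z j).2‖ ^ 2) ≤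
      ∫ s in Icc 0 t, expMoment lam N (Φ.flow s z) :=
    setIntegral_mono_on (integrableOn_const measure_Icc_lt_top.ne)
      (integrableOn_expMoment_flow hlam.le Φ hz 0 t) measurableSet_Icc fun s _ => hpt s
  rw [hconst] at hmono
  have hkey : t * (lam * (((N + 1 : ℕ) : ℝ)⁻¹ * ∑ j, ‖(z j).2‖ ^ 2)) ≤ Cexp := hmono.trans h
  rw [le_div_iff₀ (mul_pos hlam ht)]
  calc (∑ j, ‖(z j).2‖ ^ 2) * (lam * t) = ((N + 1 : ℕ) : ℝ) * (t * (lam * (((N + 1 : ℕ) : ℝ)⁻¹ *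
        ∑ j, ‖(z j).2‖ ^ 2))) := by field_simp
    _ ≤ ((N + 1 : ℕ) : ℝ) * Cexp := mul_le_mul_of_nonneg_left hkey hN.le

/-- A horizon integral of the flow moments shifted by the window, over `[Δℓ, t]`, is a horizon integral
over `[0, t − Δℓ]`, hence at most the one over `[0, t]` (non-negative integrand). -/
theorem integral_shift_le {f : ℝ → ℝ} (hf0 : ∀ s, 0 ≤ f s) (hfI : ∀ a b, IntegrableOn f (Icc a b))
    {d t : ℝ} (hd : 0 ≤ d) (hdt : d ≤ t) :
    ∫ s in Icc d t, f (s - d) ≤ ∫ s in Icc 0 t, f s := by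
  rw [integral_Icc_eq_integral_Ioc, ← intervalIntegral.integral_of_le hdt,
    intervalIntegral.integral_comp_sub_right f d, sub_self, intervalIntegral.integral_of_le (by linarith),
    integral_Icc_eq_integral_Ioc]
  exact setIntegral_mono_set ((hfI 0 t).mono_set Ioc_subset_Icc_self) (ae_of_all _ fun s => hf0 s)
    (ae_of_all _ (Ioc_subset_Ioc_right (by linarith)))

/-- **The window starts cost at most twice the horizon integral**: for a good datum,
`∫₀ᵗ expMoment(Φ_{s − winLen s} z) ds ≤ 2 ∫₀ᵗ expMoment(Φ_s z) ds`. -/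
theorem integral_expMoment_winStart_le {lam : ℝ} (hlam : 0 ≤ lam) (Φ : Flow σ N) {z : Cfg N}
    (hz : z ∈ Φ.good) (t : ℝ) :
    ∫ s in Icc 0 t, expMoment lam N (winStart σ N Φ s z) ≤
      2 * ∫ s in Icc 0 t, expMoment lam N (Φ.flow s z) := by
  set f : ℝ → ℝ := fun s => expMoment lam N (Φ.flow s z) with hf
  set g : ℝ → ℝ := fun s => if s < Δℓ N then 0 else f (s - Δℓ N) with hg
  have hf0 : ∀ s, 0 ≤ f s := fun s => expMoment_nonneg lam N _
  have hg0 : ∀ s, 0 ≤ g s := fun s => by rw [hg]; simp only; split_ifs; exacts [le_rfl, hf0 _]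
  have hfm : Measurable f := measurable_expMoment_flow lam Φ hz
  have hgm : Measurable g := Measurable.ite measurableSet_Iio measurable_const (hfm.comp (measurable_id.sub_const _))
  have hfI : ∀ a b, IntegrableOn f (Icc a b) := fun a b => integrableOn_expMoment_flow hlam Φ hz a b
  have hB : ∀ s, f s ≤ Real.exp (lam * Reduction.vR z ^ 2) := fun s => expMoment_flow_le hlam Φ hz s
  have hgI : IntegrableOn g (Icc 0 t) := by
    refine IntegrableOn.of_bound measure_Icc_lt_top hgm.aestronglyMeasurable.restrict
      (Real.exp (lam * Reduction.vR z ^ 2)) (ae_of_all _ fun s => ?_)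
    rw [Real.norm_eq_abs, abs_of_nonneg (hg0 s), hg]
    simp only
    split_ifs
    · exact (Real.exp_pos _).le
    · exact hB _
  -- pointwise: the window start is `Φ_s z` in the initial layer and `Φ_{s−Δℓ} z` afterwards
  have hpt : ∀ s, expMoment lam N (winStart σ N Φ s z) ≤ f s + g s := by
    intro s
    unfold winStart winLen
    rw [hg]
    simp only
    split_ifs with h
    · rw [sub_zero, add_zero]
    · linarith [hf0 s]
  have hwsm : Measurable fun s => expMoment lam N (winStart σ N Φ s z) :=
    (measurable_expMoment lam N).comp (Reduction.measurable_winStart Φ hz)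
  have hwsI : IntegrableOn (fun s => expMoment lam N (winStart σ N Φ s z)) (Icc 0 t) := by
    refine IntegrableOn.of_bound measure_Icc_lt_top hwsm.aestronglyMeasurable.restrict
      (2 * Real.exp (lam * Reduction.vR z ^ 2)) (ae_of_all _ fun s => ?_)
    rw [Real.norm_eq_abs, abs_of_nonneg (expMoment_nonneg lam N _)]
    refine (hpt s).trans ?_
    have h1 := hB s
    have h2 : g s ≤ Real.exp (lam * Reduction.vR z ^ 2) := by
      rw [hg]; simp only; split_ifs; exacts [(Real.exp_pos _).le, hB _]
    linarith
  -- the shifted part costs at most one horizon integral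
  have hgle : ∫ s in Icc 0 t, g s ≤ ∫ s in Icc 0 t, f s := by
    rcases lt_or_ge t (Δℓ N) with hlt | hle
    · have h0 : ∫ s in Icc 0 t, g s = 0 := by
        refine setIntegral_eq_zero_of_forall_eq_zero fun s hs => ?_
        rw [hg]; simp only; rw [if_pos (lt_of_le_of_lt hs.2 hlt)]
      rw [h0]
      exact setIntegral_nonneg measurableSet_Icc fun s _ => hf0 s
    · have hind : g = (Ici (Δℓ N)).indicator (fun s => f (s - Δℓ N)) := by
        funext s
        rw [hg]; simp only [Set.indicator, mem_Ici]
        split_ifs with h1 h2 h2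
        · exact absurd h2 (not_le.2 h1)
        · rfl
        · rfl
        · exact absurd (not_lt.1 h1) h2
      have hset : Icc 0 t ∩ Ici (Δℓ N) = Icc (Δℓ N) t := by
        ext s
        simp only [mem_inter_iff, mem_Icc, mem_Ici]
        constructor
        · rintro ⟨⟨-, h2⟩, h3⟩; exact ⟨h3, h2⟩
        · rintro ⟨h1, h2⟩; exact ⟨⟨(ColumnDepolarisation.lineWindow_pos N).le.trans h1, h2⟩, h1⟩
      rw [hind, setIntegral_indicator measurableSet_Ici, hset]
      exact integral_shift_le hf0 hfI (ColumnDepolarisation.lineWindow_pos N).le hle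
  calc ∫ s in Icc 0 t, expMoment lam N (winStart σ N Φ s z) ≤ ∫ s in Icc 0 t, (f s + g s) :=
        setIntegral_mono_on hwsI ((hfI 0 t).add hgI) measurableSet_Icc fun s _ => hpt s
    _ = (∫ s in Icc 0 t, f s) + ∫ s in Icc 0 t, g s := integral_add (hfI 0 t) hgI
    _ ≤ 2 * ∫ s in Icc 0 t, f s := by linarith

/-! ## The few-steps input in real form -/

/-- Along a good orbit the number of fold steps of the line window is measurable in time, as a real. -/
theorem measurable_steps_win_real (hG : (Torus.geometry (Fin 3)).IsHardSphereRegular (hsDiameter σ N))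
    (Φ : Flow σ N) {z : Cfg N} (hz : z ∈ Φ.good) :
    Measurable fun s => (steps σ N (winStart σ N Φ s z) (winLen N s) : ℝ) :=
  measurable_from_top.comp (Reduction.measurable_steps_win hG Φ hz)

/-- **The few-steps input in real form**: if the lower integral of the number of fold steps over
`[0, t]` is at most `ofReal B` (`B ≥ 0`), so is the real integral. -/
theorem integral_steps_le_of_lintegral_le (hG : (Torus.geometry (Fin 3)).IsHardSphereRegular (hsDiameter σ N))
    (Φ : Flow σ N) {z : Cfg N} (hz : z ∈ Φ.good) {t B : ℝ} (hB : 0 ≤ B)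
    (h : ∫⁻ s in Icc 0 t, (steps σ N (winStart σ N Φ s z) (winLen N s) : ℝ≥0∞) ≤ ENNReal.ofReal B) :
    ∫ s in Icc 0 t, (steps σ N (winStart σ N Φ s z) (winLen N s) : ℝ) ≤ B := by
  have hm := measurable_steps_win_real hG Φ hz
  rw [integral_eq_lintegral_of_nonneg_ae (ae_of_all _ fun s => Nat.cast_nonneg _)
    hm.aestronglyMeasurable.restrict]
  have heq : ∫⁻ s in Icc 0 t, ENNReal.ofReal (steps σ N (winStart σ N Φ s z) (winLen N s) : ℝ) =
      ∫⁻ s in Icc 0 t, (steps σ N (winStart σ N Φ s z) (winLen N s) : ℝ≥0∞) :=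
    lintegral_congr fun s => ENNReal.ofReal_natCast _
  rw [heq]
  exact ENNReal.toReal_le_of_le_ofReal hB h

/-- Registered anchor of this helper file (the integrand of `TailsOn` is the exponential moment along
the flow, `tails_integral_eq` with `expMoment` unfolded). -/
theorem pastDamping_windows_anchor : ∀ (lam σ : ℝ) (N : ℕ) (Φ : Flow σ N) (z : Cfg N) (t : ℝ), ∫ s in Set.Icc 0 t, ∫ y, Real.exp (lam * ‖y.2‖ ^ 2) ∂(Literature.Analysis.FluidPDE.empiricalMeasure (Φ.flow s z)) = ∫ s in Set.Icc 0 t, ((N + 1 : ℕ) : ℝ)⁻¹ * ∑ i : Fin (N + 1), Real.exp (lam * ‖(Φ.flow s z i).2‖ ^ 2) :=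
  fun lam _ _ Φ z t => tails_integral_eq lam Φ z t

end

end PastDamping
end Summit.AtomisticToContinuum.HydrodynamicLimit.Theorems.ContactSourceDuhamel.TimeLocal
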